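import Summits.BirchSwinnertonDyer.BirchSwinnertonDyer.Theorems.QuadraticBranchSignedControlPlusEtaNonsurjConjADoorHecke
import Summits.BirchSwinnertonDyer.BirchSwinnertonDyer.Theorems.QuadraticBranchSignedControlPlusEtaNonsurjFineRoadConjA
import HarnessLib

/-!
# Route `QuadraticBranchSignedControl` (rung K8, cell `bsd-potss`), residual crux `PlusEtaMainConjectureNonsurj`
# (stmt-BirchSwinnertonDyer-19606): HECKE DOOR ∘ FINE ROAD — the integral Kato inclusion at `η` and (C1⁺_η) on the prime-`L` rank-1,
# rank-0 and CM rank-0 shapes from the HECKE-REFINED eigen datum (seat `bsd-potss-k8eta-c2` g21, sequel of p704214 `…ConjADoorHecke`)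

WHAT. p704214 (`EtaConjADoorHecke.conjA_partner_of_heckeEigenHom`, fact-free) gives statement (A) for the partner `W` of a row `V` of crux 19606
from the Hecke-refined tautological eigen datum on `K = ℚ(P)` (+ `hVH`): numerically «hecke13 verdict TWIST-TYPE or `T = 0`», i.e. the
tautological class of `Cl(ℚ(P)) ⊗ 𝔽_p` comes from `Sel₀(ℚ, V[p])` or a companion, not from `W` (k8eta-c2 g21 census: 18 in-table rows and 4
family rows at `p = 5`; «RHO ⟺ s_W ≥ 1» on 69/69 tautological rows). This file feeds it to k8eta-c2 g6's fine road BY NAME exactly as p691623 /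
p703312 did with the class-number data: the INTEGRAL Kato inclusion at `η`, (C1⁺_η) on the prime-`L` rank-1 shape (the in-table Hecke rows with `λ⁺ = 1` at `p = 5`: 44100j1, 243675bl1, 324900en1, 148225cc1, 378225bg1, 326700ga1 — census table
`E5-CLASSIFICATION-k8eta-c2-g21.tsv`), the rank-0 shape and the CM rank-0 shape.

HONEST FRAMING (cell `bsd-potss`; FULL-BSD rank ≤ 1 programme, HUMAN RULING D-0036/D-0074): TOOL THEOREMS ONLY — no definition, no named
fact, no `sorry`, axioms standard; CONDITIONAL on the displayed named facts and per-row data (the Hecke datum and `hVH` stay displayed). No stub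
of 19606 is proved by name; the crux stays OPEN; nothing is booked; (A) and `BSD(W,p)` are claimed for no pair. `--supports stmt-BirchSwinnertonDyer-19606 --as helper`.

References: [Kobayashi2003] Thm. 2.2 (p. 5), §4 Even main conjecture + Thm. 4.1 (p. 8), Thm. 6.2/6.3/7.3 i) (p. 13); [CoatesSujatha2005] §3 (A),
Thm. 3.4; [DeoRaySujatha2023] Thm. 3.8; [GreenbergLNM1716] §4 Lemma 4.2; [KitajimaOtsuki2018] Thm. 1.3; [Miller2011LMS] Def. 1.1; [BurungaleFlach2024] Thm. 1.1.
-/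

set_option autoImplicit false
set_option linter.dupNamespace false
noncomputable section

open scoped Classical nonZeroDivisors

open NumberField IsDedekindDomain Field WeierstrassCurve
open Literature.NumberTheory.EllipticCurves Literature.NumberTheory.GaloisRepresentations
  Literature.NumberTheory.EllipticCurves.Rank1Residual Literature.NumberTheory.NumberFields
open Literature.NumberTheory.EllipticCurves.CoatesSujatha2005
open Summit.BirchSwinnertonDyer.Rank1Residual Summit.BirchSwinnertonDyer.Rank1Residual.GaloisImage

namespace Summit.BirchSwinnertonDyer.BirchSwinnertonDyer.Theorems.EtaConjADoorHecke

variable (p : ℕ) [hp : Fact p.Prime]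

/-! ## Hecke door ∘ the fine road BY NAME (as p691623 / p703312, with the Hecke-refined eigen datum) -/

section Upper

open CongruenceSubgroup Literature.NumberTheory.EllipticCurves.ModularForms
  Literature.NumberTheory.EllipticCurves.Rank1Residual.Typed Literature.NumberTheory.GaloisCohomology
  Literature.NumberTheory.EllipticCurves.GreenbergVatsal2000 ZpExtension
open Summit.BirchSwinnertonDyer.Rank1Residual.Additive

variable (V : WeierstrassCurve ℚ) [V.IsElliptic] [V.IsGloballyMinimal] (W : WeierstrassCurve ℚ) [W.IsElliptic]
  [W.IsGloballyMinimal] (C : VariableChange ℚ)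

omit [W.IsGloballyMinimal] in
/-- **The INTEGRAL Kato-side inclusion at `η` on a row from the Hecke-refined eigen datum and the analytic `μ`** — the Hecke door
(`conjA_partner_of_heckeEigenHom`) fed to k8eta-c2 g6's fine road `EtaFineRoad.etaUpperIntegral_of_conjA_of_analyticMu` (cf. p691623 / p703312).
Named facts `h22 h41 h6273`; displayed: the Hecke-refined eigen datum (+ `hVH`), `μ_an = 0`. CONDITIONAL; nothing booked.
[cite: Kobayashi2003, Thm. 4.1 first display (p. 8), Thm. 2.2 (p. 5), Thm. 7.3 i) (7.21) (p. 13)] [cite: CoatesSujatha2005, §3 (A) and Thm. 3.4] -/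
theorem etaUpperIntegral_of_heckeEigenHom_of_analyticMu
    (h22 : Kobayashi2003.thm22_etaSignedSelmerDual_finite_torsion)
    (h41 : Kobayashi2003.thm41_plusEtaCharIdeal_dvd)
    (h6273 : Kobayashi2003.thm62_63_73_etaColemanPoitouTate)
    [NeZero p] (hp5 : 5 ≤ p) (hC : C • W.quadraticTwist ((-1) ^ (p / 2) * p) = V)
    (hgood : V.HasGoodReductionAtPrime p) (hap : V.frobeniusTrace p = 0)
    (hns : ¬ ∀ m : ℕ, V.HasSurjectiveModNGaloisRep (p ^ m : ℕ))
    (hP : haveI : NumberField (W.divisionField p) := NumberField.mk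
      ∃ P : geomTorsion W (p : ℤ), P ≠ 0 ∧
        ∀ K : IntermediateField ℚ (W.divisionField p),
          K = IntermediateField.fixedField
            ((MulAction.stabilizer (absoluteGaloisGroup ℚ) P).map (absRestrictNormalHom (W.divisionField p))) →
        (∀ v : geomTorsion W (p : ℤ),
          (∀ τ : absoluteGaloisGroup ℚ,
            (∀ x : K, absRestrictNormalHom (W.divisionField p) τ (x : W.divisionField p) = x) → τ • v = v) →
          ∃ c : ℕ, v = c • P) ∧
        ∀ μ : Additive (ClassGroup (𝓞 K)) →+ ZMod p,
          (∀ (τ : absoluteGaloisGroup ℚ) (σ : K ≃ₐ[ℚ] K) (a : ℕ),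
              (∀ x : K, absRestrictNormalHom (W.divisionField p) τ (x : W.divisionField p) =
                ((σ x : K) : W.divisionField p)) → τ • P = a • P →
              ∀ (I J : (Ideal (𝓞 K))⁰),
                (J : Ideal (𝓞 K)) = (I : Ideal (𝓞 K)).map (AmbiguousClass.intAut σ : 𝓞 K →+* 𝓞 K) →
                μ (Additive.ofMul (ClassGroup.mk0 J)) = a • μ (Additive.ofMul (ClassGroup.mk0 I))) →
          (∀ (τ τ₁ : absoluteGaloisGroup ℚ) (a a₁ b : ℕ) (Q : geomTorsion W (p : ℤ)),
              τ • P = a • P + Q → τ₁ • P = a₁ • P → τ₁ • Q = b • Q → (a₁ : ZMod p) ≠ (b : ZMod p) →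
              ∀ I : (Ideal (𝓞 K))⁰,
                μ (Additive.ofMul (classGroupNorm K (W.divisionField p) (ClassGroup.mulEquiv
                  (AmbiguousClass.intAut (absRestrictNormalHom (W.divisionField p) τ))
                    (classGroupExtend K (W.divisionField p) (ClassGroup.mk0 I))))) =
                  (Nat.card ((W.divisionField p) ≃ₐ[K] (W.divisionField p)) * a) •
                    μ (Additive.ofMul (ClassGroup.mk0 I))) →
          μ = 0)
    (hμan : ∀ {N : ℕ} [NeZero N] {f : CuspForm (Gamma0 N) 2}, IsNewformOf V f →
      ∀ (ϖ : ℚ), (if Even (p / 2) then (ϖ : ℝ) * V.realPeriodRat = plusPeriod f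
          else (ϖ : ℝ) * V.imaginaryPeriodRat = minusPeriod f) →
      ∀ (Lη : IwasawaAlgebra p), IsQuadraticBranchPlusLFunction f p ϖ Lη → HasUnitContent Lη) :
    ∀ (K₀ : Type) [Field K₀] [NumberField K₀] [IsCyclotomicExtension {p} ℚ K₀]
        [(galRange (K := ℚ) K₀).Normal] (ηq : absoluteGaloisGroup ℚ →* ℤˣ),
        (∀ σ ∈ galRange (K := ℚ) K₀, ηq σ = 1) → ηq ≠ 1 →
      ∀ {N : ℕ} [NeZero N] {f : CuspForm (Gamma0 N) 2},
        p ≠ 2 → V.HasGoodReductionAtPrime p → V.frobeniusTrace p = 0 → IsNewformOf V f →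
      ∀ (ϖ : ℚ), (if Even (p / 2) then (ϖ : ℝ) * V.realPeriodRat = plusPeriod f
          else (ϖ : ℝ) * V.imaginaryPeriodRat = minusPeriod f) →
      ∀ (Lη : IwasawaAlgebra p), IsQuadraticBranchPlusLFunction f p ϖ Lη →
      ∀ (κ : ZpExtension ℚ p) (γ : absoluteGaloisGroup ℚ),
        κ.IsCyclotomic → κ.IsTopGenerator γ → γ ∈ galRange (K := ℚ) K₀ → IsCyclotomicVariable p γ →
      ∀ (D : EtaSignedSelmerDualData V κ K₀ ℚ_[p] ηq γ 1), Ideal.span {Lη} ≤ D.charIdeal :=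
  EtaFineRoad.etaUpperIntegral_of_conjA_of_analyticMu W p h22 h41 h6273 V C hC
    (conjA_partner_of_heckeEigenHom p V W C hp5 hC hgood hap hns hP) hμan

omit [W.IsGloballyMinimal] in
/-- **Prime-`L` rank-`1` shape: (C1⁺_η)(V) from the Hecke-refined eigen datum ALONE** (granted `h22 h41 h6273`): `Sel_{p^∞}(W/ℚ)`
infinite and `(L_p⁺(V,η,X)) = (X)` + the datum ⟹ `QuadraticBranchPlusEtaMainConjectureAt V p` — the Hecke door fed to
`EtaFineRoad.quadraticBranchPlusEtaMainConjectureAt_of_span_eq_span_X_of_conjA` (census k8eta-c2 g21: the in-table rank-1 `λ⁺ = 1` rows of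
Hecke type TWIST at `p = 5`). CONDITIONAL; nothing booked.
[cite: Kobayashi2003, §4 Even main conjecture and Thm. 4.1 first display (p. 8), Thm. 7.3 i) (p. 13)] [cite: CoatesSujatha2005, §3 statement (A)]
[cite: GreenbergLNM1716, §4 Lemma 4.2 (p. 102)] -/
theorem quadraticBranchPlusEtaMainConjectureAt_of_heckeEigenHom_of_span_eq_span_X
    (h22 : Kobayashi2003.thm22_etaSignedSelmerDual_finite_torsion)
    (h41 : Kobayashi2003.thm41_plusEtaCharIdeal_dvd)
    (h6273 : Kobayashi2003.thm62_63_73_etaColemanPoitouTate)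
    [NeZero p] (hp5 : 5 ≤ p) (hC : C • W.quadraticTwist ((-1) ^ (p / 2) * p) = V)
    (hgood : V.HasGoodReductionAtPrime p) (hap : V.frobeniusTrace p = 0)
    (hns : ¬ ∀ m : ℕ, V.HasSurjectiveModNGaloisRep (p ^ m : ℕ))
    (hinf : ¬ Finite ↥(W.selmerGroupPInfty p))
    (hX : ∀ {N : ℕ} [NeZero N] {f : CuspForm (Gamma0 N) 2}, IsNewformOf V f →
      ∀ (ϖ : ℚ), (if Even (p / 2) then (ϖ : ℝ) * V.realPeriodRat = plusPeriod f
          else (ϖ : ℝ) * V.imaginaryPeriodRat = minusPeriod f) →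
      ∀ (Lη : IwasawaAlgebra p), IsQuadraticBranchPlusLFunction f p ϖ Lη →
        Ideal.span {Lη} = Ideal.span {(PowerSeries.X : IwasawaAlgebra p)})
    (hP : haveI : NumberField (W.divisionField p) := NumberField.mk
      ∃ P : geomTorsion W (p : ℤ), P ≠ 0 ∧
        ∀ K : IntermediateField ℚ (W.divisionField p),
          K = IntermediateField.fixedField
            ((MulAction.stabilizer (absoluteGaloisGroup ℚ) P).map (absRestrictNormalHom (W.divisionField p))) →
        (∀ v : geomTorsion W (p : ℤ),
          (∀ τ : absoluteGaloisGroup ℚ,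
            (∀ x : K, absRestrictNormalHom (W.divisionField p) τ (x : W.divisionField p) = x) → τ • v = v) →
          ∃ c : ℕ, v = c • P) ∧
        ∀ μ : Additive (ClassGroup (𝓞 K)) →+ ZMod p,
          (∀ (τ : absoluteGaloisGroup ℚ) (σ : K ≃ₐ[ℚ] K) (a : ℕ),
              (∀ x : K, absRestrictNormalHom (W.divisionField p) τ (x : W.divisionField p) =
                ((σ x : K) : W.divisionField p)) → τ • P = a • P →
              ∀ (I J : (Ideal (𝓞 K))⁰),
                (J : Ideal (𝓞 K)) = (I : Ideal (𝓞 K)).map (AmbiguousClass.intAut σ : 𝓞 K →+* 𝓞 K) →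
                μ (Additive.ofMul (ClassGroup.mk0 J)) = a • μ (Additive.ofMul (ClassGroup.mk0 I))) →
          (∀ (τ τ₁ : absoluteGaloisGroup ℚ) (a a₁ b : ℕ) (Q : geomTorsion W (p : ℤ)),
              τ • P = a • P + Q → τ₁ • P = a₁ • P → τ₁ • Q = b • Q → (a₁ : ZMod p) ≠ (b : ZMod p) →
              ∀ I : (Ideal (𝓞 K))⁰,
                μ (Additive.ofMul (classGroupNorm K (W.divisionField p) (ClassGroup.mulEquiv
                  (AmbiguousClass.intAut (absRestrictNormalHom (W.divisionField p) τ))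
                    (classGroupExtend K (W.divisionField p) (ClassGroup.mk0 I))))) =
                  (Nat.card ((W.divisionField p) ≃ₐ[K] (W.divisionField p)) * a) •
                    μ (Additive.ofMul (ClassGroup.mk0 I))) →
          μ = 0) :
    QuadraticBranchPlusEtaMainConjectureAt V p :=
  EtaFineRoad.quadraticBranchPlusEtaMainConjectureAt_of_span_eq_span_X_of_conjA W p h22 h41 h6273 V C hp5 hC hgood hap
    hinf hX (conjA_partner_of_heckeEigenHom p V W C hp5 hC hgood hap hns hP)

/-- **Rank-`0` shape: (C1⁺_η)(V) from the Hecke-refined eigen datum, the analytic `μ`, `L(W,1) ≠ 0` and the lower bound `L₀(W,p)`** —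
the Hecke door fed to `EtaFineRoad.quadraticBranchPlusEtaMainConjectureAt_of_conjA_of_analyticMu_of_missingLowerBoundAt`. Named facts
`hPT hmod hGZK h22 h41 hKO h6273`. CONDITIONAL; nothing booked. [cite: Kobayashi2003, §4 Even main conjecture and Thm. 4.1 (p. 8), Thm. 7.3 i) (p. 13)]
[cite: CoatesSujatha2005, §3 statement (A)] [cite: Miller2011LMS, Def. 1.1] -/
theorem quadraticBranchPlusEtaMainConjectureAt_of_heckeEigenHom_of_analyticMu_of_missingLowerBoundAt
    (hPT : poitouTate_selmerStructure_duality_real ℚ) (hmod : hasEntireLFunction_rat)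
    (hGZK : rank_eq_analyticRank_of_analyticRank_le_one)
    (h22 : Kobayashi2003.thm22_etaSignedSelmerDual_finite_torsion)
    (h41 : Kobayashi2003.thm41_plusEtaCharIdeal_dvd)
    (hKO : KitajimaOtsuki2018.mainThm13_etaSignedSelmerDual_noFiniteSubmodule)
    (h6273 : Kobayashi2003.thm62_63_73_etaColemanPoitouTate)
    [NeZero p] (hp5 : 5 ≤ p) (hC : C • W.quadraticTwist ((-1) ^ (p / 2) * p) = V)
    (hgood : V.HasGoodReductionAtPrime p) (hap : V.frobeniusTrace p = 0)
    (hns : ¬ ∀ m : ℕ, V.HasSurjectiveModNGaloisRep (p ^ m : ℕ))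
    (hP : haveI : NumberField (W.divisionField p) := NumberField.mk
      ∃ P : geomTorsion W (p : ℤ), P ≠ 0 ∧
        ∀ K : IntermediateField ℚ (W.divisionField p),
          K = IntermediateField.fixedField
            ((MulAction.stabilizer (absoluteGaloisGroup ℚ) P).map (absRestrictNormalHom (W.divisionField p))) →
        (∀ v : geomTorsion W (p : ℤ),
          (∀ τ : absoluteGaloisGroup ℚ,
            (∀ x : K, absRestrictNormalHom (W.divisionField p) τ (x : W.divisionField p) = x) → τ • v = v) →
          ∃ c : ℕ, v = c • P) ∧
        ∀ μ : Additive (ClassGroup (𝓞 K)) →+ ZMod p,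
          (∀ (τ : absoluteGaloisGroup ℚ) (σ : K ≃ₐ[ℚ] K) (a : ℕ),
              (∀ x : K, absRestrictNormalHom (W.divisionField p) τ (x : W.divisionField p) =
                ((σ x : K) : W.divisionField p)) → τ • P = a • P →
              ∀ (I J : (Ideal (𝓞 K))⁰),
                (J : Ideal (𝓞 K)) = (I : Ideal (𝓞 K)).map (AmbiguousClass.intAut σ : 𝓞 K →+* 𝓞 K) →
                μ (Additive.ofMul (ClassGroup.mk0 J)) = a • μ (Additive.ofMul (ClassGroup.mk0 I))) →
          (∀ (τ τ₁ : absoluteGaloisGroup ℚ) (a a₁ b : ℕ) (Q : geomTorsion W (p : ℤ)),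
              τ • P = a • P + Q → τ₁ • P = a₁ • P → τ₁ • Q = b • Q → (a₁ : ZMod p) ≠ (b : ZMod p) →
              ∀ I : (Ideal (𝓞 K))⁰,
                μ (Additive.ofMul (classGroupNorm K (W.divisionField p) (ClassGroup.mulEquiv
                  (AmbiguousClass.intAut (absRestrictNormalHom (W.divisionField p) τ))
                    (classGroupExtend K (W.divisionField p) (ClassGroup.mk0 I))))) =
                  (Nat.card ((W.divisionField p) ≃ₐ[K] (W.divisionField p)) * a) •
                    μ (Additive.ofMul (ClassGroup.mk0 I))) →
          μ = 0)
    (hμan : ∀ {N : ℕ} [NeZero N] {f : CuspForm (Gamma0 N) 2}, IsNewformOf V f →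
      ∀ (ϖ : ℚ), (if Even (p / 2) then (ϖ : ℝ) * V.realPeriodRat = plusPeriod f
          else (ϖ : ℝ) * V.imaginaryPeriodRat = minusPeriod f) →
      ∀ (Lη : IwasawaAlgebra p), IsQuadraticBranchPlusLFunction f p ϖ Lη → HasUnitContent Lη)
    (hLW : W.entireLFunction 1 ≠ 0) (hlow : MissingLowerBoundAt W p) :
    QuadraticBranchPlusEtaMainConjectureAt V p :=
  EtaFineRoad.quadraticBranchPlusEtaMainConjectureAt_of_conjA_of_analyticMu_of_missingLowerBoundAt W p hPT hmod hGZK h22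
    h41 hKO h6273 V C hp5 hC hgood hap
    (conjA_partner_of_heckeEigenHom p V W C hp5 hC hgood hap hns hP) hμan hLW hlow

/-- **CM rank-`0` shape: (C1⁺_η)(V) from the Hecke-refined eigen datum, the analytic `μ` and `L(W,1) ≠ 0`** (the lower half is bsd.S28) —
the Hecke door fed to `EtaFineRoad.quadraticBranchPlusEtaMainConjectureAt_of_conjA_of_analyticMu_of_hasCM_rankZero` (census g21: 8 CM rank-0 Hecke rows).
Named facts `hPT hmod hGZK h22 h41 hKO hS28 h6273`. CONDITIONAL; nothing booked. [cite: Kobayashi2003, §4 Even main conjecture and Thm. 4.1 (p. 8)]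
[cite: BurungaleFlach2024, Thm 1.1 and Cor. 2] [cite: CoatesSujatha2005, §3 statement (A)] -/
theorem quadraticBranchPlusEtaMainConjectureAt_of_heckeEigenHom_of_analyticMu_of_hasCM_rankZero
    (hPT : poitouTate_selmerStructure_duality_real ℚ) (hmod : hasEntireLFunction_rat)
    (hGZK : rank_eq_analyticRank_of_analyticRank_le_one)
    (h22 : Kobayashi2003.thm22_etaSignedSelmerDual_finite_torsion)
    (h41 : Kobayashi2003.thm41_plusEtaCharIdeal_dvd)
    (hKO : KitajimaOtsuki2018.mainThm13_etaSignedSelmerDual_noFiniteSubmodule)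
    (hS28 : bsdTriple_of_hasCM_of_L_one_ne_zero)
    (h6273 : Kobayashi2003.thm62_63_73_etaColemanPoitouTate)
    [NeZero p] (hp5 : 5 ≤ p) (hC : C • W.quadraticTwist ((-1) ^ (p / 2) * p) = V)
    (hgood : V.HasGoodReductionAtPrime p) (hap : V.frobeniusTrace p = 0)
    (hns : ¬ ∀ m : ℕ, V.HasSurjectiveModNGaloisRep (p ^ m : ℕ)) (hCM : V.HasCM)
    (hP : haveI : NumberField (W.divisionField p) := NumberField.mk
      ∃ P : geomTorsion W (p : ℤ), P ≠ 0 ∧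
        ∀ K : IntermediateField ℚ (W.divisionField p),
          K = IntermediateField.fixedField
            ((MulAction.stabilizer (absoluteGaloisGroup ℚ) P).map (absRestrictNormalHom (W.divisionField p))) →
        (∀ v : geomTorsion W (p : ℤ),
          (∀ τ : absoluteGaloisGroup ℚ,
            (∀ x : K, absRestrictNormalHom (W.divisionField p) τ (x : W.divisionField p) = x) → τ • v = v) →
          ∃ c : ℕ, v = c • P) ∧
        ∀ μ : Additive (ClassGroup (𝓞 K)) →+ ZMod p,
          (∀ (τ : absoluteGaloisGroup ℚ) (σ : K ≃ₐ[ℚ] K) (a : ℕ),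
              (∀ x : K, absRestrictNormalHom (W.divisionField p) τ (x : W.divisionField p) =
                ((σ x : K) : W.divisionField p)) → τ • P = a • P →
              ∀ (I J : (Ideal (𝓞 K))⁰),
                (J : Ideal (𝓞 K)) = (I : Ideal (𝓞 K)).map (AmbiguousClass.intAut σ : 𝓞 K →+* 𝓞 K) →
                μ (Additive.ofMul (ClassGroup.mk0 J)) = a • μ (Additive.ofMul (ClassGroup.mk0 I))) →
          (∀ (τ τ₁ : absoluteGaloisGroup ℚ) (a a₁ b : ℕ) (Q : geomTorsion W (p : ℤ)),
              τ • P = a • P + Q → τ₁ • P = a₁ • P → τ₁ • Q = b • Q → (a₁ : ZMod p) ≠ (b : ZMod p) →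
              ∀ I : (Ideal (𝓞 K))⁰,
                μ (Additive.ofMul (classGroupNorm K (W.divisionField p) (ClassGroup.mulEquiv
                  (AmbiguousClass.intAut (absRestrictNormalHom (W.divisionField p) τ))
                    (classGroupExtend K (W.divisionField p) (ClassGroup.mk0 I))))) =
                  (Nat.card ((W.divisionField p) ≃ₐ[K] (W.divisionField p)) * a) •
                    μ (Additive.ofMul (ClassGroup.mk0 I))) →
          μ = 0)
    (hμan : ∀ {N : ℕ} [NeZero N] {f : CuspForm (Gamma0 N) 2}, IsNewformOf V f →
      ∀ (ϖ : ℚ), (if Even (p / 2) then (ϖ : ℝ) * V.realPeriodRat = plusPeriod f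
          else (ϖ : ℝ) * V.imaginaryPeriodRat = minusPeriod f) →
      ∀ (Lη : IwasawaAlgebra p), IsQuadraticBranchPlusLFunction f p ϖ Lη → HasUnitContent Lη)
    (hLW : W.entireLFunction 1 ≠ 0) :
    QuadraticBranchPlusEtaMainConjectureAt V p :=
  EtaFineRoad.quadraticBranchPlusEtaMainConjectureAt_of_conjA_of_analyticMu_of_hasCM_rankZero W p hPT hmod hGZK h22 h41
    hKO hS28 h6273 V C hp5 hC hgood hap hCM
    (conjA_partner_of_heckeEigenHom p V W C hp5 hC hgood hap hns hP) hμan hLW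

end Upper

end Summit.BirchSwinnertonDyer.BirchSwinnertonDyer.Theorems.EtaConjADoorHecke

end
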